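import Summits.CriticalPhenomena.SAWScalingLimit.Theorems.SAWTotalPositivityCriticalBubbleBoundJoinSurgeryDefs
import Summits.CriticalPhenomena.SAWScalingLimit.Theorems.SAWTotalPositivityCriticalBubbleBoundJoinLeftQuarter

/-!
# The ENTROPY input of the join-mass ledger
(crux `SAWTotalPositivity.CriticalBubbleBound`, stmt-CriticalPhenomena-7117; line `docking-census-joining`,
registered stubs `card_verts_le_box`, `card_offsets_ge`, `Dent_ge` of the join-mass programme, lead prover c6)

`Dent_ge`: there are `c > 0` and `i₀` with `c · 2^{i/2} · R'_i² ≤ D_i` for `i ≥ i₀`, where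
`R'_i = blockMass jterm i` is the shifted class block mass and `D_i = Dent i` the entropy-side mass
(number of admissible offsets of the Madras join, summed over pairs of classes of scale `i`).
Hammond's Lemma 4.9/4.11 in the class model: tall-left classes are at least a quarter of all classes
(`card_lexRooted_le_four_mul`), a tall class with `V ≍ 2^i` vertices has height `≥ √V - 1`
(`card_verts_le_box`), a left class has its tip in the upper half, and the admissible offsets number at
least `min (tipRow - 2) (ymax₂ + 1) ≳ 2^{i/2}` (`card_offsets_ge`). [cite: Hammond2015SAPJoining, Lemma 4.11]
-/

noncomputable section

open Literature.Probability.LatticeModels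
open Literature.Probability.RandomPlanarGeometry Literature.Probability.RandomPlanarGeometry.SAW
open scoped BigOperators
open Summit.CriticalPhenomena.SAWScalingLimit.Theorems.CriticalBubbleBound.Negative (e₀)
open Summit.CriticalPhenomena.SAWScalingLimit.Theorems.CriticalBubbleBound.Docking

namespace Summit.CriticalPhenomena.SAWScalingLimit.Theorems.CriticalBubbleBound.Join

/-! ## Bounding box and offsets -/

/-- The vertices of a rooted polygon fit in its bounding box: `#verts ≤ (w + 1)(h + 1)` (registered
stub `card_verts_le_box`). [folklore] -/
theorem card_verts_le_box : ∀ (n : ℕ) (χ : ℕ → Site 2),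
    ((verts n χ).card : ℤ) ≤ (width n χ + 1) * (height n χ + 1) := by
  intro n χ
  classical
  set B : Finset (ℤ × ℤ) := Finset.Icc (xmin n χ) (xmax n χ) ×ˢ Finset.Icc (ymin n χ) (ymax n χ) with hB
  have hmaps : Set.MapsTo (fun p : Site 2 => (p 0, p 1)) ↑(verts n χ) ↑B := by
    intro p hp
    rw [Finset.mem_coe] at hp
    obtain ⟨i, hi, rfl⟩ := Finset.mem_image.1 hp
    have hi' : i ≤ n := Nat.lt_succ_iff.1 (Finset.mem_range.1 hi)
    rw [Finset.mem_coe, hB, Finset.mem_product, Finset.mem_Icc, Finset.mem_Icc]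
    exact ⟨⟨xmin_le_apply χ hi', apply_le_xmax χ hi'⟩, ⟨ymin_le_apply χ hi', apply_le_ymax χ hi'⟩⟩
  have hinj : Set.InjOn (fun p : Site 2 => (p 0, p 1)) ↑(verts n χ) := by
    intro p _ q _ hpq
    simp only [Prod.mk.injEq] at hpq
    funext i
    fin_cases i
    · exact hpq.1
    · exact hpq.2
  have hcard := Finset.card_le_card_of_injOn _ hmaps hinj
  have hw : 0 ≤ width n χ := by
    have := xmin_le_apply χ (Nat.zero_le n)
    have := apply_le_xmax χ (Nat.zero_le n)
    simp only [width]; omega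
  have hh : 0 ≤ height n χ := by
    have := ymin_le_apply χ (Nat.zero_le n)
    have := apply_le_ymax χ (Nat.zero_le n)
    simp only [height]; omega
  have hBcard : (B.card : ℤ) = (width n χ + 1) * (height n χ + 1) := by
    rw [hB, Finset.card_product, Int.card_Icc, Int.card_Icc, Nat.cast_mul]
    simp only [width, height] at hw hh ⊢
    rw [Int.toNat_of_nonneg (by omega), Int.toNat_of_nonneg (by omega)]
    ring
  calc ((verts n χ).card : ℤ) ≤ B.card := by exact_mod_cast hcard
    _ = _ := hBcard

/-- For a lex-rooted class the top row is nonnegative (the root lies on row `0`). [folklore] -/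
theorem ymax_nonneg_of_mem_lexRooted {m : ℕ} {χ : ℕ → Site 2} (h : χ ∈ lexRooted m) : 0 ≤ ymax m χ := by
  have h0 : χ 0 = 0 := (Zd.mem_sawFun.1 (lexRooted_subset m h)).1
  have := apply_le_ymax χ (Nat.zero_le m)
  rw [h0] at this
  simpa using this

/-- For a lex-rooted class the bottom row is row `0`. [folklore] -/
theorem ymin_eq_zero_of_mem_lexRooted {m : ℕ} {χ : ℕ → Site 2} (h : χ ∈ lexRooted m) : ymin m χ = 0 := by
  have h0 : χ 0 = 0 := (Zd.mem_sawFun.1 (lexRooted_subset m h)).1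
  refine le_antisymm ?_ ?_
  · have := ymin_le_apply χ (Nat.zero_le m)
    rw [h0] at this
    simpa using this
  · obtain ⟨i, hi, hiy⟩ := exists_apply_eq_ymin m χ
    rw [← hiy]
    exact apply_one_nonneg_of_mem_lexRooted h hi

/-- A rooted `n`-step self-avoiding walk has exactly `n + 1` vertices. [folklore] -/
theorem card_verts_eq {n : ℕ} {χ : ℕ → Site 2} (h : χ ∈ Zd.sawFun 2 n e₀) : (verts n χ).card = n + 1 := by
  have hinj := (Zd.mem_sawFun.1 h).2.2.2
  rw [Docking.verts, Finset.card_image_of_injOn, Finset.card_range]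
  intro i hi j hj hij
  rw [Finset.mem_coe, Finset.mem_range] at hi hj
  exact hinj (Nat.lt_succ_iff.1 hi) (Nat.lt_succ_iff.1 hj) hij

/-- Count of admissible offsets: `#offsets ≥ min (tipRow - 2) (ymax₂ + 1)` (registered stub
`card_offsets_ge`). [cite: Hammond2015SAPJoining, Lemma 4.11] -/
theorem card_offsets_ge : ∀ (j m : ℕ) (χ₁ χ₂ : ℕ → Site 2), χ₂ ∈ lexRooted m →
    (min (tipRow j χ₁ - 2) (ymax m χ₂ + 1) : ℤ) ≤ ((offsets j m χ₁ χ₂).card : ℤ) := by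
  intro j m χ₁ χ₂ hχ₂
  have hy := ymax_nonneg_of_mem_lexRooted hχ₂
  rw [offsets, Int.card_Icc]
  set t := tipRow j χ₁
  set y := ymax m χ₂
  rcases le_total 3 (t - y) with h3 | h3
  · rw [max_eq_right h3]
    have : t + 1 - (t - y) = y + 1 := by ring
    rw [this, Int.toNat_of_nonneg (by omega)]
    exact min_le_right _ _
  · rw [max_eq_left h3]
    rcases le_total 0 (t + 1 - 3) with hpos | hneg
    · rw [Int.toNat_of_nonneg hpos]
      have : t + 1 - 3 = t - 2 := by ring
      rw [this]
      exact min_le_left _ _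
    · rw [Int.toNat_of_nonpos hneg]
      have : t - 2 ≤ 0 := by omega
      exact le_trans (min_le_left _ _) (by exact_mod_cast this)

/-! ## The geometric core: a tall-left pair of scale `i` has `≳ 2^{i/2}` admissible offsets -/

/-- A tall class with at least `V` vertices has `(height + 1)² ≥ V`. [cite: Hammond2015SAPJoining, Definition 4.8] -/
theorem sq_height_ge {n : ℕ} {χ : ℕ → Site 2} (h : χ ∈ lexRooted n) (ht : IsTall n χ) :
    ((n : ℤ) + 1) ≤ (height n χ + 1) * (height n χ + 1) := by
  have hbox := card_verts_le_box n χ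
  rw [card_verts_eq (lexRooted_subset n h)] at hbox
  have hw : 0 ≤ width n χ := by
    have := xmin_le_apply χ (Nat.zero_le n)
    have := apply_le_xmax χ (Nat.zero_le n)
    simp only [width]; omega
  have hh : 0 ≤ height n χ := by
    have := ymin_le_apply χ (Nat.zero_le n)
    have := apply_le_ymax χ (Nat.zero_le n)
    simp only [height]; omega
  have hwh : width n χ ≤ height n χ := ht
  push_cast at hbox
  nlinarith

/-- The offsets bound for a left/left pair of shifted indices at least `2^i`, `i ≥ 12`:
`2^{i/2} / 4 ≤ #offsets`. [cite: Hammond2015SAPJoining, Lemma 4.11] -/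
theorem offsets_ge_scale {i n n' : ℕ} (hi : 12 ≤ i) (hn : 2 ^ i ≤ n) (hn' : 2 ^ i ≤ n')
    {χ₁ χ₂ : ℕ → Site 2} (h₁ : χ₁ ∈ lexRooted (n - joinShift)) (h₂ : χ₂ ∈ lexRooted (n' - joinShift))
    (hl₁ : IsLeftPoly (n - joinShift) χ₁) (hl₂ : IsLeftPoly (n' - joinShift) χ₂) :
    (2 : ℝ) ^ ((1 / 2 : ℝ) * (i : ℝ)) / 4 ≤
      ((offsets (n - joinShift) (n' - joinShift) χ₁ χ₂).card : ℝ) := by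
  set S : ℝ := (2 : ℝ) ^ ((1 / 2 : ℝ) * (i : ℝ)) with hS
  have hS0 : 0 ≤ S := Real.rpow_nonneg (by norm_num) _
  have hS2 : S ^ 2 = (2 : ℝ) ^ i := by
    rw [hS, ← Real.rpow_natCast ((2 : ℝ) ^ ((1 / 2 : ℝ) * (i : ℝ))) 2,
      ← Real.rpow_mul (by norm_num : (0 : ℝ) ≤ 2)]
    have : (1 / 2 : ℝ) * (i : ℝ) * ((2 : ℕ) : ℝ) = ((i : ℕ) : ℝ) := by push_cast; ring
    rw [this, Real.rpow_natCast]
  -- `2^i ≥ 4096`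
  have hpow : (4096 : ℝ) ≤ (2 : ℝ) ^ i := by
    have : (2 : ℝ) ^ 12 ≤ (2 : ℝ) ^ i := pow_le_pow_right₀ (by norm_num) hi
    norm_num at this
    exact this
  have hS20 : 20 ≤ S := by nlinarith
  -- heights
  have hh₁ := sq_height_ge h₁ hl₁.1
  have hh₂ := sq_height_ge h₂ hl₂.1
  have hn17 : 17 ≤ n := le_trans (by norm_num) (le_trans (pow_le_pow_right₀ (by norm_num) hi) hn)
  have hn17' : 17 ≤ n' := le_trans (by norm_num) (le_trans (pow_le_pow_right₀ (by norm_num) hi) hn')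
  have hcast₁ : ((n - joinShift : ℕ) : ℝ) = (n : ℝ) - 17 := by
    have : ((n - joinShift : ℕ) : ℤ) = (n : ℤ) - 17 := by simp only [joinShift]; omega
    have h' : (((n - joinShift : ℕ) : ℤ) : ℝ) = (((n : ℤ) - 17 : ℤ) : ℝ) := by rw [this]
    push_cast at h'
    exact h'
  have hcast₂ : ((n' - joinShift : ℕ) : ℝ) = (n' : ℝ) - 17 := by
    have : ((n' - joinShift : ℕ) : ℤ) = (n' : ℤ) - 17 := by simp only [joinShift]; omega
    have h' : (((n' - joinShift : ℕ) : ℤ) : ℝ) = (((n' : ℤ) - 17 : ℤ) : ℝ) := by rw [this]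
    push_cast at h'
    exact h'
  set H₁ : ℝ := (height (n - joinShift) χ₁ : ℝ) with hH₁
  set H₂ : ℝ := (height (n' - joinShift) χ₂ : ℝ) with hH₂
  have hH₁' : (n : ℝ) - 16 ≤ (H₁ + 1) * (H₁ + 1) := by
    have h' : ((n - joinShift : ℕ) : ℝ) + 1 ≤ (H₁ + 1) * (H₁ + 1) := by
      rw [hH₁]; exact_mod_cast hh₁
    rw [hcast₁] at h'; linarith
  have hH₂' : (n' : ℝ) - 16 ≤ (H₂ + 1) * (H₂ + 1) := by
    have h' : ((n' - joinShift : ℕ) : ℝ) + 1 ≤ (H₂ + 1) * (H₂ + 1) := by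
      rw [hH₂]; exact_mod_cast hh₂
    rw [hcast₂] at h'; linarith
  have hnR : (2 : ℝ) ^ i ≤ n := by exact_mod_cast hn
  have hnR' : (2 : ℝ) ^ i ≤ n' := by exact_mod_cast hn'
  -- `(3S/4)² ≤ 2^i - 16`
  have h34 : (3 * S / 4) ^ 2 ≤ (2 : ℝ) ^ i - 16 := by nlinarith
  have hH₁0 : 0 ≤ H₁ + 1 := by
    have := ymin_le_apply χ₁ (Nat.zero_le (n - joinShift))
    have := apply_le_ymax χ₁ (Nat.zero_le (n - joinShift))
    have : (0 : ℤ) ≤ height (n - joinShift) χ₁ := by simp only [height]; omega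
    have : (0 : ℝ) ≤ H₁ := by rw [hH₁]; exact_mod_cast this
    linarith
  have hH₂0 : 0 ≤ H₂ + 1 := by
    have := ymin_le_apply χ₂ (Nat.zero_le (n' - joinShift))
    have := apply_le_ymax χ₂ (Nat.zero_le (n' - joinShift))
    have : (0 : ℤ) ≤ height (n' - joinShift) χ₂ := by simp only [height]; omega
    have : (0 : ℝ) ≤ H₂ := by rw [hH₂]; exact_mod_cast this
    linarith
  have hH₁S : 3 * S / 4 ≤ H₁ + 1 := by nlinarith
  have hH₂S : 3 * S / 4 ≤ H₂ + 1 := by nlinarith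
  -- tip of `χ₁` in the upper half; `ymin = 0`
  have hy₁ : ymin (n - joinShift) χ₁ = 0 := ymin_eq_zero_of_mem_lexRooted h₁
  have hy₂ : ymin (n' - joinShift) χ₂ = 0 := ymin_eq_zero_of_mem_lexRooted h₂
  have htip : H₁ ≤ 2 * (tipRow (n - joinShift) χ₁ : ℝ) := by
    have := hl₁.2
    rw [hy₁, zero_add] at this
    have h' : (ymax (n - joinShift) χ₁ : ℝ) ≤ 2 * (tipRow (n - joinShift) χ₁ : ℝ) := by exact_mod_cast this
    have hH : H₁ = (ymax (n - joinShift) χ₁ : ℝ) := by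
      rw [hH₁, height, hy₁, sub_zero]
    rw [hH]; exact h'
  have hym : H₂ = (ymax (n' - joinShift) χ₂ : ℝ) := by rw [hH₂, height, hy₂, sub_zero]
  -- the offsets count
  have hoff := card_offsets_ge (n - joinShift) (n' - joinShift) χ₁ χ₂ h₂
  have hoffR : min ((tipRow (n - joinShift) χ₁ : ℝ) - 2) ((ymax (n' - joinShift) χ₂ : ℝ) + 1) ≤
      ((offsets (n - joinShift) (n' - joinShift) χ₁ χ₂).card : ℝ) := by
    have := hoff
    have h' : ((min (tipRow (n - joinShift) χ₁ - 2) (ymax (n' - joinShift) χ₂ + 1) : ℤ) : ℝ) ≤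
        (((offsets (n - joinShift) (n' - joinShift) χ₁ χ₂).card : ℤ) : ℝ) := by exact_mod_cast this
    push_cast at h'
    exact h'
  refine le_trans ?_ hoffR
  rw [le_min_iff]
  constructor
  · linarith
  · rw [← hym]; linarith

/-! ## The registered stub -/

open Classical in
/-- **The entropy input of the ledger** (registered stub `Dent_ge`): `c · 2^{i/2} · R'_i² ≤ D_i` for
`i ≥ i₀` with `c = 1/64`, `i₀ = 12`. [cite: Hammond2015SAPJoining, Lemma 4.12 (arrow count)] -/
theorem Dent_ge : ∃ c : ℝ, 0 < c ∧ ∃ i₀ : ℕ, ∀ i : ℕ, i₀ ≤ i →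
    c * (2 : ℝ) ^ ((1 / 2 : ℝ) * (i : ℝ)) * blockMass jterm i ^ 2 ≤ Dent i := by
  refine ⟨1 / 64, by norm_num, 12, fun i hi => ?_⟩
  set S : ℝ := (2 : ℝ) ^ ((1 / 2 : ℝ) * (i : ℝ)) with hS
  have hS0 : 0 ≤ S := Real.rpow_nonneg (by norm_num) _
  have hx0 : 0 ≤ criticalFugacity := criticalFugacity_pos_lt_one'.1.le
  -- the left classes of shifted index `n`
  set L : ℕ → Finset (ℕ → Site 2) := fun n => (lexRooted (n - joinShift)).filter (IsLeftPoly (n - joinShift))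
    with hL
  set A : ℕ → ℝ := fun n => ((L n).card : ℝ) * criticalFugacity ^ (n - joinShift + 1) with hA
  have hA0 : ∀ n, 0 ≤ A n := fun n => mul_nonneg (Nat.cast_nonneg _) (pow_nonneg hx0 _)
  have hblock : ∀ n ∈ block i, 2 ^ i ≤ n := fun n hn => (Finset.mem_Ico.1 hn).1
  have h17 : ∀ n ∈ block i, joinShift ≤ n := fun n hn =>
    le_trans (by norm_num [joinShift]) (le_trans (pow_le_pow_right₀ (by norm_num) hi) (hblock n hn))
  have h3 : ∀ n ∈ block i, 3 ≤ n - joinShift := fun n hn => by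
    have := le_trans (pow_le_pow_right₀ (by norm_num : 1 ≤ 2) hi) (hblock n hn)
    simp only [joinShift]; omega
  -- Step 1: `jterm n ≤ 4 A n`
  have hstep1 : ∀ n ∈ block i, jterm n ≤ 4 * A n := by
    intro n hn
    rw [jterm_of_le (h17 n hn), cterm]
    have h4 := card_lexRooted_le_four_mul (n - joinShift) (h3 n hn)
    have h4' : ((lexRooted (n - joinShift)).card : ℝ) ≤ 4 * ((L n).card : ℝ) := by
      rw [hL]; exact_mod_cast h4
    calc ((lexRooted (n - joinShift)).card : ℝ) * criticalFugacity ^ (n - joinShift + 1)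
        ≤ 4 * ((L n).card : ℝ) * criticalFugacity ^ (n - joinShift + 1) :=
          mul_le_mul_of_nonneg_right h4' (pow_nonneg hx0 _)
      _ = 4 * A n := by rw [hA]; ring
  -- Step 2/3: lower bound of `Dent i` by the left/left pairs with the uniform offsets bound
  have hpair : ∀ n ∈ block i, ∀ n' ∈ block i,
      S / 4 * (A n * A n') ≤
        ∑ χ₁ ∈ lexRooted (n - joinShift), ∑ χ₂ ∈ lexRooted (n' - joinShift),
          ((offsets (n - joinShift) (n' - joinShift) χ₁ χ₂).card : ℝ) *
            criticalFugacity ^ (n - joinShift + 1 + (n' - joinShift + 1)) := by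
    intro n hn n' hn'
    have hsub : ∑ χ₁ ∈ L n, ∑ χ₂ ∈ L n',
        ((offsets (n - joinShift) (n' - joinShift) χ₁ χ₂).card : ℝ) *
          criticalFugacity ^ (n - joinShift + 1 + (n' - joinShift + 1)) ≤
        ∑ χ₁ ∈ lexRooted (n - joinShift), ∑ χ₂ ∈ lexRooted (n' - joinShift),
          ((offsets (n - joinShift) (n' - joinShift) χ₁ χ₂).card : ℝ) *
            criticalFugacity ^ (n - joinShift + 1 + (n' - joinShift + 1)) := by
      refine le_trans (Finset.sum_le_sum fun χ₁ _ => ?_) (Finset.sum_le_sum_of_subset_of_nonneg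
        (Finset.filter_subset _ _) fun χ₁ _ _ => Finset.sum_nonneg fun χ₂ _ =>
          mul_nonneg (Nat.cast_nonneg _) (pow_nonneg hx0 _))
      exact Finset.sum_le_sum_of_subset_of_nonneg (Finset.filter_subset _ _) fun χ₂ _ _ =>
        mul_nonneg (Nat.cast_nonneg _) (pow_nonneg hx0 _)
    refine le_trans ?_ hsub
    have hlow : ∑ χ₁ ∈ L n, ∑ χ₂ ∈ L n',
        S / 4 * criticalFugacity ^ (n - joinShift + 1 + (n' - joinShift + 1)) ≤
        ∑ χ₁ ∈ L n, ∑ χ₂ ∈ L n',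
          ((offsets (n - joinShift) (n' - joinShift) χ₁ χ₂).card : ℝ) *
            criticalFugacity ^ (n - joinShift + 1 + (n' - joinShift + 1)) := by
      refine Finset.sum_le_sum fun χ₁ hχ₁ => Finset.sum_le_sum fun χ₂ hχ₂ => ?_
      rw [hL] at hχ₁ hχ₂
      simp only [Finset.mem_filter] at hχ₁ hχ₂
      exact mul_le_mul_of_nonneg_right
        (offsets_ge_scale hi (hblock n hn) (hblock n' hn') hχ₁.1 hχ₂.1 hχ₁.2 hχ₂.2) (pow_nonneg hx0 _)
    refine le_trans (le_of_eq ?_) hlow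
    simp only [hA, Finset.sum_const, nsmul_eq_mul, pow_add]
    ring
  have hDent : S / 4 * (∑ n ∈ block i, A n) ^ 2 ≤ Dent i := by
    rw [Dent, sq, Finset.sum_mul_sum, Finset.mul_sum]
    refine Finset.sum_le_sum fun n hn => ?_
    rw [Finset.mul_sum]
    refine Finset.sum_le_sum fun n' hn' => ?_
    rw [if_pos ⟨h17 n hn, h17 n' hn'⟩]
    exact hpair n hn n' hn'
  -- Step 4: `R' ≤ 4 Σ A`
  have hR : blockMass jterm i ≤ 4 * ∑ n ∈ block i, A n := by
    rw [blockMass, Finset.mul_sum]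
    exact Finset.sum_le_sum fun n hn => hstep1 n hn
  have hR0 : 0 ≤ blockMass jterm i := blockMass_nonneg jterm_nonneg i
  have hsum0 : 0 ≤ ∑ n ∈ block i, A n := Finset.sum_nonneg fun n _ => hA0 n
  calc 1 / 64 * S * blockMass jterm i ^ 2 = S / 4 * (blockMass jterm i / 4) ^ 2 := by ring
    _ ≤ S / 4 * (∑ n ∈ block i, A n) ^ 2 := by
        apply mul_le_mul_of_nonneg_left _ (by positivity)
        apply pow_le_pow_left₀ (by positivity)
        linarith
    _ ≤ Dent i := hDent

end Summit.CriticalPhenomena.SAWScalingLimit.Theorems.CriticalBubbleBound.Join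

end
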